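import Literature.NumberTheory.ConnesConsani2021.ProlateProjectionsAngleProofs
import Literature.NumberTheory.ConnesConsani2021.ArchDensityOfMajorant
import Mathlib.Analysis.SpecialFunctions.Integrals.Basic
import HarnessLib

/-!
# Connes–Consani 2021, Lemma 5.4 numerics (`ε′(1⁺) = Σ t(n) ≈ 22.9965`): the INDEX-FREE TAIL FRAME
# a kernel certificate plugs into (PROVED; no numerics here)

RH-FREE corpus literature (label, line 1): Bessel-inequality bookkeeping for the prolate series
`Σ_n t(n)`, `t(n) = 2λ(n)²ψ_n(1)²/(1−λ(n)²)`; nothing in this file mentions `ζ`, the critical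
strip or RH, and nothing here bears on the truth of RH.  bears_on (cell rh-crit, corpus C1): apex
input (B) — route «ConnesConsaniSemilocal» item K2 `DensitySlope` (stmt 19308), the (E-b) conjunct
`22.9 ≤ Σ' t(n) ≤ 23.1` of `CC2021_section6_enclosures`.

Source: A. Connes, C. Consani, *Weil positivity and trace formula, the archimedean place*, Selecta
Math. (N.S.) 27 (2021) 77 = arXiv:2006.13771 [bib `ConnesConsani2021`], Lemma 5.4 §5 pp. 32–33
(arXiv item Lemma 31, chunk p0020:L86–L106: "`ε′(1⁺) ≃ 22.9965`", "the first few terms …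
`11.9719 + 8.77574 + 2.20528 + 0.0433983 + 0.000125459 + …`"), with §4 p. 16 ((74)/(cosalphan):
`⟨ψ_n, cos 2πy·⟩ = λ(n)ψ_n(y)`) and Prop. 4.5 (iii) proof p. 17 (orthonormality of the `ξ_n`).

## What is here (all PROVED, 0 definitions, 0 facts)

The printed evaluation sums four terms and waves the rest away; a certified version needs an
INDEX-FREE bound on "all other members".  This file proves it from Bessel's inequality for the
orthonormal family `ξ_n` (tree theorem `CC2021_sec4_xi_orthonormal_holds`) tested against the
cut-off COSINE wave `c_y = 1_{[−1,1]} cos(2πy·)` (norm² `1 + sin 4πy/(4πy)`, `= 1` at `y = 1`;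
the tree's `sum_sq_prolateEigen_mul_sq_le` uses the complex wave, norm² `2`, too weak at `y = 1`):
* `norm_cutoffCosWave_sq` (`‖c_y‖² = 1 + cos(2πy)sin(2πy)/(2πy)`, `y ≠ 0`),
  `inner_cutoffCosWave_prolateXi` (`⟨c_y|ξ_n⟩ = λ(n)ψ_n(y)` on `[−1,1]`);
* `sum_sq_prolateEigen_mul_sq_le_cos` — Bessel: `Σ_{n∈s} λ(n)²ψ_n(y)² ≤ ‖c_y‖²`;
  `sum_sq_prolateEigen_mul_sq_one_le` — at `y = 1`: `Σ_{n∈s} λ(n)²ψ_n(1)² ≤ 1`;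
  `sum_sq_prolateEigen_mul_sq_le_of_quarter_le` — `≤ 1 + 1/π` for `¼ ≤ |y| ≤ 1`;
  `sum_sq_prolateEigen_le_crude` — integrated: `Σ_{n∈s} λ(n)² ≤ 5/2 + 3/(2π)` (`< 2.978`);
* **`tsum_epsSlopeTerm_le_of_finset` / `sum_epsSlopeTerm_le_tsum` /
  `summable_epsSlopeTerm_of_finset` — THE FRAME**: for a finset `F` and reals
  `S ≤ Σ_{k∈F} λ(k)²ψ_k(1)²`, `M ≤ Σ_{k∈F} λ(k)²` with
  `Λ := 5/2 + 3/(2π) − M < 1`: `Σ t` is summable and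
  `Σ_{k∈F} t(k) ≤ Σ' t ≤ Σ_{k∈F} t(k) + 2(1−S)/(1−Λ)`.
With the engine's certified four members (`S ≥ 0.99989`, `M ≥ 2.2374`, cc/engine/ebpack) this
gives `Λ ≤ 0.741` and a tail `≤ 8.2·10⁻⁴` against a slack of `0.09` — the kernel certificate
(a separate file) supplies `F` and the per-member enclosures.

WHAT THIS IS NOT: no enclosure of `Σ' t(n)` is proved here (no numerics at all); no statement about
`ζ` or RH; nothing here bears on the truth of RH.
-/

noncomputable section

open Real MeasureTheory Set Filter Complex
open scoped InnerProductSpace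

namespace Literature.NumberTheory.ConnesConsani2021

open Literature.NumberTheory.LFunctions

/-! ## The cut-off cosine wave `c_y = 1_{[−1,1]} cos(2πy·)` in `L²(ℝ)` -/

/-- The cut-off cosine wave is bounded by `1`. [folklore] -/
private theorem norm_cutoffCosWave_le (y x : ℝ) :
    ‖(Icc (-1 : ℝ) 1).indicator (fun x : ℝ ↦ ((Real.cos (2 * π * x * y) : ℝ) : ℂ)) x‖ ≤ 1 := by
  by_cases hx : x ∈ Icc (-1 : ℝ) 1
  · rw [indicator_of_mem hx, Complex.norm_real, Real.norm_eq_abs]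
    exact Real.abs_cos_le_one _
  · rw [indicator_of_notMem hx, norm_zero]; exact zero_le_one

/-- The cut-off cosine wave is integrable. [folklore] -/
private theorem integrable_cutoffCosWave (y : ℝ) :
    Integrable ((Icc (-1 : ℝ) 1).indicator fun x : ℝ ↦ ((Real.cos (2 * π * x * y) : ℝ) : ℂ)) := by
  refine IntegrableOn.integrable_indicator ?_ measurableSet_Icc
  exact (by fun_prop : Continuous fun x : ℝ ↦ ((Real.cos (2 * π * x * y) : ℝ) : ℂ)).integrableOn_Icc

/-- `c_y ∈ L²(ℝ)`. [cite: ConnesConsani2021, Prop. 4.5 (iii) proof §4 p. 17 (arXiv p0017:L26)] -/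
theorem memLp_cutoffCosWave (y : ℝ) :
    MemLp ((Icc (-1 : ℝ) 1).indicator fun x : ℝ ↦ ((Real.cos (2 * π * x * y) : ℝ) : ℂ)) 2
      (volume : Measure ℝ) :=
  Literature.Analysis.FluidPDE.FourierNS.memLp_two_of_bound (integrable_cutoffCosWave y)
    (norm_cutoffCosWave_le y)

/-- `‖c_y‖² = ∫_{−1}^{1} cos²(2πxy) dx`.
[cite: ConnesConsani2021, Prop. 4.5 (iii) proof §4 p. 17 (arXiv p0017:L26)] -/
theorem norm_cutoffCosWave_sq_eq_integral (y : ℝ) :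
    ‖(memLp_cutoffCosWave y).toLp _‖ ^ 2 = ∫ x in (-1 : ℝ)..1, Real.cos (2 * π * x * y) ^ 2 := by
  rw [← inner_self_eq_norm_sq (𝕜 := ℂ) ((memLp_cutoffCosWave y).toLp _), L2.inner_def]
  have h1 : ∫ x : ℝ, ⟪((memLp_cutoffCosWave y).toLp _ : ℝ → ℂ) x,
      ((memLp_cutoffCosWave y).toLp _ : ℝ → ℂ) x⟫_ℂ =
      ∫ x : ℝ, (Icc (-1 : ℝ) 1).indicator (fun x ↦ ((Real.cos (2 * π * x * y) ^ 2 : ℝ) : ℂ)) x := by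
    refine integral_congr_ae ?_
    filter_upwards [MemLp.coeFn_toLp (memLp_cutoffCosWave y)] with x hx
    rw [hx, RCLike.inner_apply]
    by_cases hxI : x ∈ Icc (-1 : ℝ) 1
    · rw [indicator_of_mem hxI, indicator_of_mem hxI, Complex.conj_ofReal]; push_cast; ring
    · simp [indicator_of_notMem hxI]
  rw [h1, integral_indicator measurableSet_Icc, integral_complex_ofReal,
    integral_Icc_eq_integral_Ioc, ← intervalIntegral.integral_of_le (by norm_num : (-1 : ℝ) ≤ 1)]
  simp

/-- `∫_{−1}^{1} cos²(2πxy) dx = 1 + cos(2πy) sin(2πy)/(2πy)` (`y ≠ 0`) — the squared norm of the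
test vector in the Bessel step of Prop. 4.5 (iii), cosine form.
[cite: ConnesConsani2021, Prop. 4.5 (iii) proof §4 p. 17 (arXiv p0017:L26)] -/
theorem integral_cos_sq_two_pi_mul {y : ℝ} (hy : y ≠ 0) :
    ∫ x in (-1 : ℝ)..1, Real.cos (2 * π * x * y) ^ 2
      = 1 + Real.cos (2 * π * y) * Real.sin (2 * π * y) / (2 * π * y) := by
  have hc : 2 * π * y ≠ 0 := by positivity
  have h := intervalIntegral.integral_comp_mul_left (fun u ↦ Real.cos u ^ 2) hc (a := -1) (b := 1)
  have e : (fun x ↦ Real.cos (2 * π * x * y) ^ 2) = fun x ↦ Real.cos (2 * π * y * x) ^ 2 := by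
    funext x; ring_nf
  rw [e, h, integral_cos_sq, smul_eq_mul]
  rw [show 2 * π * y * -1 = -(2 * π * y) by ring, mul_one, Real.cos_neg, Real.sin_neg]
  field_simp
  ring

/-- `‖c_y‖² = 1 + cos(2πy) sin(2πy)/(2πy)` (`y ≠ 0`).
[cite: ConnesConsani2021, Prop. 4.5 (iii) proof §4 p. 17 (arXiv p0017:L26)] -/
theorem norm_cutoffCosWave_sq {y : ℝ} (hy : y ≠ 0) :
    ‖(memLp_cutoffCosWave y).toLp _‖ ^ 2
      = 1 + Real.cos (2 * π * y) * Real.sin (2 * π * y) / (2 * π * y) := by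
  rw [norm_cutoffCosWave_sq_eq_integral, integral_cos_sq_two_pi_mul hy]

/-- **`⟨c_y|ξ_n⟩ = ∫_{−1}^{1} ψ_n(x) cos(2πxy) dx = η̃_n(y)`** (the cosine transform).
[cite: ConnesConsani2021, §4 p. 16 eq. (74)/(cosalphan) (arXiv p0016:L25–L28)] -/
theorem inner_cutoffCosWave_prolateXi (y : ℝ) (n : ℕ) :
    ⟪(memLp_cutoffCosWave y).toLp _, prolateXi n⟫_ℂ
      = ((cosTransform (prolateFun n) y : ℝ) : ℂ) := by
  rw [L2.inner_def, cosTransform]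
  have h1 : ∫ x : ℝ, ⟪((memLp_cutoffCosWave y).toLp _ : ℝ → ℂ) x, (prolateXi n : ℝ → ℂ) x⟫_ℂ =
      ∫ x : ℝ, (Icc (-1 : ℝ) 1).indicator
        (fun x ↦ ((prolateFun n x * Real.cos (2 * π * x * y) : ℝ) : ℂ)) x := by
    refine integral_congr_ae ?_
    filter_upwards [MemLp.coeFn_toLp (memLp_cutoffCosWave y), prolateXi_coeFn n] with x hx hξ
    rw [hx, hξ, RCLike.inner_apply]
    by_cases hxI : x ∈ Icc (-1 : ℝ) 1
    · rw [indicator_of_mem hxI, indicator_of_mem hxI, Complex.conj_ofReal, prolateXiFun]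
      push_cast; ring
    · simp [indicator_of_notMem hxI, prolateXiFun, prolateFun_eq_zero_of_notMem hxI]
  rw [h1, integral_indicator measurableSet_Icc, integral_complex_ofReal,
    integral_Icc_eq_integral_Ioc, ← intervalIntegral.integral_of_le (by norm_num : (-1 : ℝ) ≤ 1)]

/-- (74)/(cosalphan) for THE prolate vectors: `η̃_n(y) = λ(n)ψ_n(y)` on `[−1,1]` (a tree theorem,
`CC2021_sec4_cosalphan_holds`, in cosine-transform form).
[cite: ConnesConsani2021, §4 p. 16 eq. (cosalphan) (arXiv p0016:L25–L28)] -/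
theorem cosTransform_prolateFun_eq {y : ℝ} (hy : y ∈ Icc (-1 : ℝ) 1) (n : ℕ) :
    cosTransform (prolateFun n) y = prolateEigen n * prolateFun n y := by
  obtain ⟨χ, hχ⟩ := exists_isAppCoreDatum_prolateFun n
  exact hχ.cosTransform_eq y hy


/-! ## Bessel against the cosine wave -/

/-- **Bessel's inequality against `c_y`**: for `y ∈ [−1,1]` and every finite set of indices,
`Σ_n λ(n)²ψ_n(y)² = Σ_n |⟨ξ_n|c_y⟩|² ≤ ‖c_y‖²`.
[cite: ConnesConsani2021, Prop. 4.5 (iii) proof §4 p. 17 (arXiv p0017:L26); §4 p. 16 (arXiv p0016:L22–L28)] -/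
theorem sum_sq_prolateEigen_mul_sq_le_cos {y : ℝ} (hy : y ∈ Icc (-1 : ℝ) 1) (s : Finset ℕ) :
    ∑ n ∈ s, prolateEigen n ^ 2 * prolateFun n y ^ 2 ≤ ‖(memLp_cutoffCosWave y).toLp _‖ ^ 2 := by
  have hB := CC2021_sec4_xi_orthonormal_holds.sum_inner_products_le
    ((memLp_cutoffCosWave y).toLp _) (s := s)
  refine le_trans (le_of_eq ?_) hB
  refine Finset.sum_congr rfl fun n _ ↦ ?_
  rw [norm_inner_symm, inner_cutoffCosWave_prolateXi, cosTransform_prolateFun_eq hy,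
    Complex.norm_real, Real.norm_eq_abs, sq_abs, mul_pow]

/-- **At the endpoint `y = 1`: `Σ_{n∈s} λ(n)²ψ_n(1)² ≤ 1`** (`‖c_1‖² = 1 + cos 2π sin 2π/(2π) = 1`).
[cite: ConnesConsani2021, Lemma 5.4 §5 p. 33 (arXiv p0020:L101–L106)] -/
theorem sum_sq_prolateEigen_mul_sq_one_le (s : Finset ℕ) :
    ∑ n ∈ s, prolateEigen n ^ 2 * prolateFun n 1 ^ 2 ≤ 1 := by
  have h := sum_sq_prolateEigen_mul_sq_le_cos (y := 1) ⟨by norm_num, le_rfl⟩ s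
  rw [norm_cutoffCosWave_sq one_ne_zero, mul_one, Real.sin_two_pi, mul_zero, zero_div,
    add_zero] at h
  exact h

/-- For `¼ ≤ |y| ≤ 1`: `Σ_{n∈s} λ(n)²ψ_n(y)² ≤ 1 + 1/π` (`|cos·sin| ≤ ½`, `2π|y| ≥ π/2`) — the
Bessel step of Prop. 4.5 (iii) with the cosine test vector.
[cite: ConnesConsani2021, Prop. 4.5 (iii) proof §4 p. 17 (arXiv p0017:L26); §4 p. 16 (arXiv p0016:L22–L25)] -/
theorem sum_sq_prolateEigen_mul_sq_le_of_quarter_le {y : ℝ} (hy : y ∈ Icc (-1 : ℝ) 1)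
    (hq : 1 / 4 ≤ |y|) (s : Finset ℕ) :
    ∑ n ∈ s, prolateEigen n ^ 2 * prolateFun n y ^ 2 ≤ 1 + 1 / π := by
  have hy0 : y ≠ 0 := by
    intro h; rw [h, abs_zero] at hq; norm_num at hq
  have h := sum_sq_prolateEigen_mul_sq_le_cos hy s
  rw [norm_cutoffCosWave_sq hy0] at h
  refine h.trans ?_
  have hπ := Real.pi_pos
  have hcs : |Real.cos (2 * π * y) * Real.sin (2 * π * y)| ≤ 1 / 2 := by
    rw [abs_le]
    constructor
    · nlinarith [sq_nonneg (Real.cos (2 * π * y) + Real.sin (2 * π * y)),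
        Real.cos_sq_add_sin_sq (2 * π * y)]
    · nlinarith [sq_nonneg (Real.cos (2 * π * y) - Real.sin (2 * π * y)),
        Real.cos_sq_add_sin_sq (2 * π * y)]
  have hden : π / 2 ≤ |2 * π * y| := by
    rw [abs_mul, abs_of_pos (by positivity : (0:ℝ) < 2 * π)]
    nlinarith
  have hfrac : Real.cos (2 * π * y) * Real.sin (2 * π * y) / (2 * π * y) ≤ 1 / π := by
    refine le_trans (le_abs_self _) ?_
    rw [abs_div, div_le_iff₀ (lt_of_lt_of_le (by positivity) hden)]
    calc |Real.cos (2 * π * y) * Real.sin (2 * π * y)| ≤ 1 / 2 := hcs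
      _ = 1 / π * (π / 2) := by field_simp
      _ ≤ 1 / π * |2 * π * y| := mul_le_mul_of_nonneg_left hden (by positivity)
  linarith

/-- **Integrated Bessel, crude constant**: `Σ_{n∈s} λ(n)² ≤ 5/2 + 3/(2π)` (`< 2.978`) for every
finite `s` — integrate the pointwise bounds (`≤ 2` on `|y| ≤ ¼` from the complex wave, `≤ 1 + 1/π`
on `¼ ≤ |y| ≤ 1`) against `∫_{−1}^{1}ψ_n² = 1`.  (The sharp constant is `2 + Si(4π)/(2π) ≈ 2.2375`.)
[cite: ConnesConsani2021, §4 p. 16 (arXiv p0016:L22–L25); Remark 4.6 (i) p. 18] -/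
theorem sum_sq_prolateEigen_le_crude (s : Finset ℕ) :
    ∑ n ∈ s, prolateEigen n ^ 2 ≤ 5 / 2 + 3 / (2 * π) := by
  have hπ := Real.pi_pos
  have hnorm : ∀ n, ∫ y in (-1 : ℝ)..1, prolateFun n y ^ 2 = 1 := fun n ↦
    (isProlateFunction_prolateFun n).norm_one
  have hcont : ∀ n, ContinuousOn (prolateFun n) (Icc (-1 : ℝ) 1) := fun n ↦
    (isProlateFunction_prolateFun n).contDiffOn.continuousOn
  set Φ : ℝ → ℝ := fun y ↦ ∑ n ∈ s, prolateEigen n ^ 2 * prolateFun n y ^ 2 with hΦ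
  have hΦc : ContinuousOn Φ (Icc (-1 : ℝ) 1) := by
    rw [hΦ]; exact continuousOn_finsetSum s fun n _ ↦ continuousOn_const.mul ((hcont n).pow 2)
  have hΦi : ∀ a b : ℝ, a ≤ b → -1 ≤ a → b ≤ 1 → IntervalIntegrable Φ volume a b := by
    intro a b hab ha hb
    refine ContinuousOn.intervalIntegrable ?_
    rw [uIcc_of_le hab]
    exact hΦc.mono (Icc_subset_Icc ha hb)
  have hsum : ∑ n ∈ s, prolateEigen n ^ 2 = ∫ y in (-1 : ℝ)..1, Φ y := by
    have hii : ∀ n, IntervalIntegrable (fun y ↦ prolateEigen n ^ 2 * prolateFun n y ^ 2)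
        volume (-1 : ℝ) 1 := fun n ↦ by
      refine ContinuousOn.intervalIntegrable ?_
      rw [uIcc_of_le (by norm_num : (-1 : ℝ) ≤ 1)]
      exact continuousOn_const.mul ((hcont n).pow 2)
    rw [hΦ, intervalIntegral.integral_finsetSum fun n _ ↦ hii n]
    refine Finset.sum_congr rfl fun n _ ↦ ?_
    rw [intervalIntegral.integral_const_mul, hnorm, mul_one]
  -- pointwise bounds
  have hmid : ∀ y ∈ Icc (-(1/4) : ℝ) (1/4), Φ y ≤ 2 := fun y hy ↦
    sum_sq_prolateEigen_mul_sq_le ⟨by linarith [hy.1], by linarith [hy.2]⟩ s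
  have hright : ∀ y ∈ Icc (1/4 : ℝ) 1, Φ y ≤ 1 + 1 / π := fun y hy ↦
    sum_sq_prolateEigen_mul_sq_le_of_quarter_le ⟨by linarith [hy.1], hy.2⟩
      (by rw [abs_of_nonneg (by linarith [hy.1])]; exact hy.1) s
  have hleft : ∀ y ∈ Icc (-1 : ℝ) (-(1/4)), Φ y ≤ 1 + 1 / π := fun y hy ↦
    sum_sq_prolateEigen_mul_sq_le_of_quarter_le ⟨hy.1, by linarith [hy.2]⟩
      (by rw [abs_of_nonpos (by linarith [hy.2])]; linarith [hy.2]) s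
  have i1 := hΦi (-1) (-(1/4)) (by norm_num) le_rfl (by norm_num)
  have i2 := hΦi (-(1/4)) (1/4) (by norm_num) (by norm_num) (by norm_num)
  have i3 := hΦi (1/4) 1 (by norm_num) (by norm_num) le_rfl
  have I1 : ∫ y in (-1 : ℝ)..(-(1/4)), Φ y ≤ ∫ _ in (-1 : ℝ)..(-(1/4)), (1 + 1 / π : ℝ) :=
    intervalIntegral.integral_mono_on (by norm_num) i1 intervalIntegrable_const hleft
  have I2 : ∫ y in (-(1/4) : ℝ)..(1/4), Φ y ≤ ∫ _ in (-(1/4) : ℝ)..(1/4), (2 : ℝ) :=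
    intervalIntegral.integral_mono_on (by norm_num) i2 intervalIntegrable_const hmid
  have I3 : ∫ y in (1/4 : ℝ)..1, Φ y ≤ ∫ _ in (1/4 : ℝ)..1, (1 + 1 / π : ℝ) :=
    intervalIntegral.integral_mono_on (by norm_num) i3 intervalIntegrable_const hright
  rw [intervalIntegral.integral_const, smul_eq_mul] at I1 I2 I3
  have hsplit : ∫ y in (-1 : ℝ)..1, Φ y
      = (∫ y in (-1 : ℝ)..(-(1/4)), Φ y) + (∫ y in (-(1/4) : ℝ)..(1/4), Φ y)
        + ∫ y in (1/4 : ℝ)..1, Φ y := by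
    rw [intervalIntegral.integral_add_adjacent_intervals i1 i2,
      intervalIntegral.integral_add_adjacent_intervals (i1.trans i2) i3]
  rw [hsum, hsplit, show 3 / (2 * π) = 3 / 2 * (1 / π) by field_simp]
  set q : ℝ := 1 / π with hq
  nlinarith


/-! ## The index-free tail frame for `Σ t(n)` -/

/-- `t(n) = 2λ(n)²ψ_n(1)²/(1−λ(n)²)` for THE prolate vectors, unfolded.
[cite: ConnesConsani2021, Lemma 5.4 §5 p. 32 (arXiv item Lemma 31)] -/
theorem epsSlopeTerm_prolateFun (n : ℕ) :
    epsSlopeTerm (prolateFun n)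
      = 2 * prolateEigen n ^ 2 / (1 - prolateEigen n ^ 2) * prolateFun n 1 ^ 2 := rfl

/-- `t(n) ≥ 0` (`|λ(n)| < 1`, a tree theorem).
[cite: ConnesConsani2021, Lemma 5.4 §5 p. 32; §4 p. 16 ("ν_n = λ(n)² < 1")] -/
theorem epsSlopeTerm_prolateFun_nonneg (n : ℕ) : 0 ≤ epsSlopeTerm (prolateFun n) := by
  rw [epsSlopeTerm_prolateFun]
  have h1 := abs_prolateEigen_lt_one n
  have h2 : prolateEigen n ^ 2 < 1 := by
    have h0 := abs_nonneg (prolateEigen n)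
    nlinarith [sq_abs (prolateEigen n)]
  have : 0 ≤ 2 * prolateEigen n ^ 2 / (1 - prolateEigen n ^ 2) :=
    div_nonneg (by positivity) (by linarith)
  positivity

/-- **Tail control of one member outside the certified set `F`**: if `M ≤ Σ_{k∈F} λ(k)²` then
every `m ∉ F` has `λ(m)² ≤ 5/2 + 3/(2π) − M`.
[cite: ConnesConsani2021, Lemma 5.4 §5 p. 33 (arXiv p0020:L101–L106); §4 p. 16] -/
theorem sq_prolateEigen_le_of_notMem {F : Finset ℕ} {M : ℝ}
    (hM : M ≤ ∑ k ∈ F, prolateEigen k ^ 2) {m : ℕ} (hm : m ∉ F) :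
    prolateEigen m ^ 2 ≤ 5 / 2 + 3 / (2 * π) - M := by
  have h := sum_sq_prolateEigen_le_crude (insert m F)
  rw [Finset.sum_insert hm] at h
  linarith

/-- **THE FRAME, finite form**: for a finset `F`, reals `S ≤ Σ_{k∈F} λ(k)²ψ_k(1)²` and
`M ≤ Σ_{k∈F} λ(k)²` with `Λ := 5/2 + 3/(2π) − M < 1`, every finite partial sum satisfies
`Σ_{n∈s} t(n) ≤ Σ_{k∈F} t(k) + 2(1−S)/(1−Λ)`.
[cite: ConnesConsani2021, Lemma 5.4 §5 pp. 32–33 (arXiv item Lemma 31, chunk p0020:L86–L106)] -/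
theorem sum_epsSlopeTerm_le_of_finset (F : Finset ℕ) {S M : ℝ}
    (hS : S ≤ ∑ k ∈ F, prolateEigen k ^ 2 * prolateFun k 1 ^ 2)
    (hM : M ≤ ∑ k ∈ F, prolateEigen k ^ 2) (hΛ : 5 / 2 + 3 / (2 * π) - M < 1) (s : Finset ℕ) :
    ∑ n ∈ s, epsSlopeTerm (prolateFun n)
      ≤ ∑ k ∈ F, epsSlopeTerm (prolateFun k) + 2 * (1 - S) / (1 - (5 / 2 + 3 / (2 * π) - M)) := by
  classical
  set Λ : ℝ := 5 / 2 + 3 / (2 * π) - M with hΛdef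
  have h1Λ : 0 < 1 - Λ := by linarith
  -- split `s` into the part inside `F` and the part outside
  have hsplit : ∑ n ∈ s, epsSlopeTerm (prolateFun n)
      = ∑ n ∈ s ∩ F, epsSlopeTerm (prolateFun n) + ∑ n ∈ s \ F, epsSlopeTerm (prolateFun n) := by
    rw [← Finset.sum_inter_add_sum_sdiff s F]
  have hin : ∑ n ∈ s ∩ F, epsSlopeTerm (prolateFun n) ≤ ∑ k ∈ F, epsSlopeTerm (prolateFun k) :=
    Finset.sum_le_sum_of_subset_of_nonneg Finset.inter_subset_right
      fun n _ _ ↦ epsSlopeTerm_prolateFun_nonneg n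
  -- outside `F`: termwise `t(m) ≤ (2/(1−Λ))·λ(m)²ψ_m(1)²`
  have hout_term : ∀ m ∈ s \ F, epsSlopeTerm (prolateFun m)
      ≤ 2 / (1 - Λ) * (prolateEigen m ^ 2 * prolateFun m 1 ^ 2) := by
    intro m hm
    have hmF : m ∉ F := (Finset.mem_sdiff.1 hm).2
    have hl : prolateEigen m ^ 2 ≤ Λ := sq_prolateEigen_le_of_notMem hM hmF
    have h1l : 0 < 1 - prolateEigen m ^ 2 := by linarith
    rw [epsSlopeTerm_prolateFun]
    have hx : 0 ≤ prolateEigen m ^ 2 * prolateFun m 1 ^ 2 := by positivity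
    have hcoef : 2 / (1 - prolateEigen m ^ 2) ≤ 2 / (1 - Λ) :=
      div_le_div_of_nonneg_left (by norm_num) h1Λ (by linarith)
    calc 2 * prolateEigen m ^ 2 / (1 - prolateEigen m ^ 2) * prolateFun m 1 ^ 2
        = 2 / (1 - prolateEigen m ^ 2) * (prolateEigen m ^ 2 * prolateFun m 1 ^ 2) := by ring
      _ ≤ 2 / (1 - Λ) * (prolateEigen m ^ 2 * prolateFun m 1 ^ 2) :=
        mul_le_mul_of_nonneg_right hcoef hx
  have hout : ∑ n ∈ s \ F, epsSlopeTerm (prolateFun n)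
      ≤ 2 / (1 - Λ) * ∑ n ∈ s \ F, prolateEigen n ^ 2 * prolateFun n 1 ^ 2 := by
    rw [Finset.mul_sum]
    exact Finset.sum_le_sum hout_term
  -- Bessel at `y = 1` on `F ∪ (s \ F)`: the outside mass is `≤ 1 − S`
  have hmass : ∑ n ∈ s \ F, prolateEigen n ^ 2 * prolateFun n 1 ^ 2 ≤ 1 - S := by
    have hdisj : Disjoint F (s \ F) := Finset.disjoint_sdiff
    have hB := sum_sq_prolateEigen_mul_sq_one_le (F ∪ (s \ F))
    rw [Finset.sum_union hdisj] at hB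
    linarith
  have h2 : 0 ≤ 2 / (1 - Λ) := by positivity
  calc ∑ n ∈ s, epsSlopeTerm (prolateFun n)
      = ∑ n ∈ s ∩ F, epsSlopeTerm (prolateFun n) + ∑ n ∈ s \ F, epsSlopeTerm (prolateFun n) :=
        hsplit
    _ ≤ ∑ k ∈ F, epsSlopeTerm (prolateFun k) + 2 / (1 - Λ) * (1 - S) :=
        add_le_add hin (hout.trans (mul_le_mul_of_nonneg_left hmass h2))
    _ = _ := by rw [hΛdef]; ring

/-- **`Σ t(n)` is summable** as soon as a certified set `F` with `Λ < 1` exists (nonnegative terms,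
bounded partial sums).
[cite: ConnesConsani2021, Lemma 5.4 §5 p. 33 ("the convergence of the series")] -/
theorem summable_epsSlopeTerm_of_finset (F : Finset ℕ) {S M : ℝ}
    (hS : S ≤ ∑ k ∈ F, prolateEigen k ^ 2 * prolateFun k 1 ^ 2)
    (hM : M ≤ ∑ k ∈ F, prolateEigen k ^ 2) (hΛ : 5 / 2 + 3 / (2 * π) - M < 1) :
    Summable (fun n ↦ epsSlopeTerm (prolateFun n)) :=
  summable_of_sum_le epsSlopeTerm_prolateFun_nonneg (sum_epsSlopeTerm_le_of_finset F hS hM hΛ)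

/-- **THE FRAME, upper half**: `Σ' t ≤ Σ_{k∈F} t(k) + 2(1−S)/(1−Λ)`.
[cite: ConnesConsani2021, Lemma 5.4 §5 pp. 32–33 (arXiv item Lemma 31, chunk p0020:L86–L106)] -/
theorem tsum_epsSlopeTerm_le_of_finset (F : Finset ℕ) {S M : ℝ}
    (hS : S ≤ ∑ k ∈ F, prolateEigen k ^ 2 * prolateFun k 1 ^ 2)
    (hM : M ≤ ∑ k ∈ F, prolateEigen k ^ 2) (hΛ : 5 / 2 + 3 / (2 * π) - M < 1) :
    ∑' n, epsSlopeTerm (prolateFun n)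
      ≤ ∑ k ∈ F, epsSlopeTerm (prolateFun k) + 2 * (1 - S) / (1 - (5 / 2 + 3 / (2 * π) - M)) :=
  (summable_epsSlopeTerm_of_finset F hS hM hΛ).tsum_le_of_sum_le
    (sum_epsSlopeTerm_le_of_finset F hS hM hΛ)

/-- **THE FRAME, lower half**: `Σ_{k∈F} t(k) ≤ Σ' t` (nonnegative terms).
[cite: ConnesConsani2021, Lemma 5.4 §5 pp. 32–33 (arXiv item Lemma 31)] -/
theorem sum_epsSlopeTerm_le_tsum (F : Finset ℕ)
    (h : Summable (fun n ↦ epsSlopeTerm (prolateFun n))) :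
    ∑ k ∈ F, epsSlopeTerm (prolateFun k) ≤ ∑' n, epsSlopeTerm (prolateFun n) :=
  h.sum_le_tsum F fun n _ ↦ epsSlopeTerm_prolateFun_nonneg n

/-- **THE FRAME, enclosure form** (what the kernel certificate feeds): certified bounds
`a ≤ Σ_{k∈F} t(k) ≤ b`, `S ≤ Σ_{k∈F} λ(k)²ψ_k(1)²`, `M ≤ Σ_{k∈F} λ(k)²` with
`b + 2(1−S)/(1−Λ) ≤ B` and `Λ = 5/2 + 3/(2π) − M < 1` give `a ≤ Σ' t ≤ B`.
[cite: ConnesConsani2021, Lemma 5.4 §5 pp. 32–33 (arXiv item Lemma 31, chunk p0020:L86–L106)] -/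
theorem tsum_epsSlopeTerm_mem_Icc_of_certificate (F : Finset ℕ) {a b S M B : ℝ}
    (ha : a ≤ ∑ k ∈ F, epsSlopeTerm (prolateFun k)) (hb : ∑ k ∈ F, epsSlopeTerm (prolateFun k) ≤ b)
    (hS : S ≤ ∑ k ∈ F, prolateEigen k ^ 2 * prolateFun k 1 ^ 2)
    (hM : M ≤ ∑ k ∈ F, prolateEigen k ^ 2) (hΛ : 5 / 2 + 3 / (2 * π) - M < 1)
    (hB : b + 2 * (1 - S) / (1 - (5 / 2 + 3 / (2 * π) - M)) ≤ B) :
    a ≤ ∑' n, epsSlopeTerm (prolateFun n) ∧ ∑' n, epsSlopeTerm (prolateFun n) ≤ B :=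
  ⟨ha.trans (sum_epsSlopeTerm_le_tsum F (summable_epsSlopeTerm_of_finset F hS hM hΛ)),
    (tsum_epsSlopeTerm_le_of_finset F hS hM hΛ).trans ((add_le_add hb le_rfl).trans hB)⟩

end Literature.NumberTheory.ConnesConsani2021

end
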